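/-
Copyright (c) 2026 the pub-hodgecm-mathlib formalisation cell (harness21).  Prover seat hodgecm-mathlib-K2E1-p12 (g3), Track B «K2-LIT» ∕ h413
(`stmt-HodgeConjecture-24833`), line `K2_E3_EllipticInputs`, MAIN leaf (11-3ns-res) `sig_K2E3CharLocIntNearSemisimpleResidualThree`, LINE-LEAD K2E3-plan (g4) L4 EMIT #4,
deal D156 + EMIT #4 RULING «ADOPT (S1), CLASSIFICATION-FREE»: THE SORRY-FREE REDUCTION OF (11-3ns-res) TO THE ONE LETTER (res3-CI) `hCI₃` (bytes by K2E3-p36 (g0)).  2026-09-04.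
-/
import Summits.HodgeConjecture.HodgeConjecture.Theorems.K2E3CharLocIntNearSemisimpleCmPrincipalSeriesThree  -- ★ p861274 (K2E2-p12): (ps-rep)₃ LETTER-FREE `charLocIntNear_cmPrincipalSeries_three` (van Dijk at `N = 3` on the MODULE `cmPrincipalSeries L 3 v χ`, near every `s`, carrier `Gqs L v`) over ★ p856769 §3
import Summits.HodgeConjecture.HodgeConjecture.Theorems.K2E3CharLocIntNearLinearCombination              -- ★ (LC) (K2E3-p11): `charLocIntNear_add`, `charLocIntNear_smul`, `charLocIntNear_congr`
import HarnessLib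

/-!
# K2_E3 road (h413), MAIN leaf (11-3ns-res) «THE RESIDUAL CLASSES» of `U(Φ₃)(L⁺_v)` — the classification-free reduction to the character-identity letter (res3-CI)

Cell `pub/hodgecm-mathlib` (D-0151), Track B, seat K2E1-p12 (g3); LINE-LEAD ∕ dealer K2E3-plan (g4), L4 EMIT #4 deal D156 (2026-09-04T15:13:07Z) and EMIT #4 RULING (15:18:05Z)
«ADOPT SHAPE (S1) CLASSIFICATION-FREE» on K2E3-p36 (g0)'s reconnaissance `K2/K2E3-p36/g0/RES3-RECON.K2E3-p36-g0.md` (c81ad87a7e95e133); the letter bytes are K2E3-p36 (g0)'s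
`K2/K2E3-p36/g0/letter_hCI3.txt` (c1a939ff247fecd6, kernel-elaborated), co-authored.  `--supports stmt-HodgeConjecture-24833 --as helper`; THEOREMS ONLY (no definition ∕ instance ∕
notation ∕ named fact ∕ `sorry`); never imports `Cruxes/…/Lines`.  COUNT-NEUTRAL until the dealer's tie `sig_K2E3CharLocIntNearSemisimpleResidualThree := residualThree_of_cut
(sig_K2E3CharLocIntNearSemisimpleResidualThreeCharIdentity)` (MAIN ED. 39∕40; PART «RES3» hosts the letter as the S-LAYER socket (res3-CI)): the theorem concludes the bytes of the MAIN
leaf (`K2_E3_EllipticInputsSigs_U12Characters.lean` :945–:960) TOKEN FOR TOKEN from ONE ∀-closed antecedent.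

THE MATHEMATICS ([Rogawski1990, §12.1 pp. 171–172, §12.2 (2)(3) pp. 173–175, L. 12.7.3, Cor. 12.7.4, p. 184]; [HarishChandra1999, Thm. 16.1]).  Let `v` be non-split,
`G = U(Φ₃)(L⁺_v)` (the socket's carrier `Gqs L v`), `χ` a continuous character of the diagonal torus with `ρ = i_G(χ) = cmPrincipalSeries L 3 v χ` REDUCIBLE and not of case (1),
and `c` a constituent.  Every such `ρ` has exactly two constituents `{c, c′}` (Rogawski §12.2 (2)(3): `{πⁿ, πˢ}`, or `{π¹, π²}` at the unitary point), `Tr ρ = Tr c + Tr c′`, and the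
printed endoscopic ∕ l.d.s. character identities give `Tr c − Tr c′ = ±χ^G_{ρ(θ)}`, an integrable function near every semisimple `s`; MERGED and classification-free this is the
letter (res3-CI) `hCI₃`: «near every semisimple `s`, the functional `2·Tr c − Tr ρ` is given by an integrable function `Δ` on a neighbourhood `U ∋ s`».  Since `Tr ρ` is given near
`s` by an integrable `Θ` (van Dijk at `N = 3` on the module, LETTER-FREE ★ p861274 `charLocIntNear_cmPrincipalSeries_three` over ★ p856769 §3), **`Tr c = ½(Tr ρ + (2·Tr c − Tr ρ))`**
is given near `s` by `½(Θ + Δ)` on `U_Θ ∩ U` — the closure of «given near `s` by an integrable function» under `+`, scalars and identities on test functions (★ (LC)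
`charLocIntNear_add` ∕ `_smul` ∕ `_congr`).  No cut, no Jordan–Hölder bookkeeping, no case list is needed at this layer (the by-kind print letters and the `L¹_loc` of the
transferred side discharge (res3-CI) later, in the socket layer, once tier-0 stub 4 `hKeysRed` lands — K2E3-p36 (g0) RES3-RECON (b)(c)).

* **`residualThree_of_cut (hCI₃) : ‹(11-3ns-res) VERBATIM›`** — `hCI₃` = the (res3-CI) bytes: binders = MAIN :947–:953 token for token (case-(1) exclusion and semisimplicity kept),
  conclusion = MAIN's with `Θ ↦ Δ` and `c.smoothTrace μ f ↦ 2 * c.smoothTrace μ f - Representation.smoothTrace (G := Gqs L v) (UnitaryGroup.cmPrincipalSeries L 3 v χ) μ f`.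

HONEST LABEL: HC_CM is proved only modulo the 7 printed citations (2 remaining named inputs: hLiu418 = stmt-HodgeConjecture-24832, h413 = stmt-HodgeConjecture-24833) until rung 0
closes; count-neutral: the tie makes (11-3ns-res) REL over EXACTLY {(res3-CI)}, an S-LAYER socket (Rogawski §12.2 (2)(3) + §12.7 ∕ §13 character identities; future R90, no prover
today) — «the socket minus van Dijk», NOT an in-house close; nothing printed is asserted as a fact.

## References
* [Rogawski1990] J. D. Rogawski, *Automorphic Representations of Unitary Groups in Three Variables*, Ann. of Math. Stud. 123 (1990), §12.1 pp. 171–172, §12.2 (2)(3) pp. 173–175,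
  Lemma 12.7.3, Cor. 12.7.4, p. 184.
* [HarishChandra1999] Harish-Chandra (DeBacker–Sally), *Admissible Invariant Distributions on Reductive p-adic Groups* (1999), Thm. 16.1 p. 77, Thm. 16.3.
* [vanDijk1972] G. van Dijk, *Computation of certain induced characters of 𝔭-adic groups*, Math. Ann. 199 (1972), Theorem p. 237.
* [GetzHahn2024] J. R. Getz, H. Hahn, *An Introduction to Automorphic Representations*, GTM 300 (2024), §8.5 (8.15) p. 159.
-/

set_option autoImplicit false
set_option linter.dupNamespace false

noncomputable section

open MeasureTheory Measure Set Filter Topology NumberField IsDedekindDomain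
open Literature.NumberTheory.Automorphic Literature.NumberTheory.Automorphic.UnitaryGroup Literature.NumberTheory.Rogawski1990
open scoped MatrixGroups
open Summit.HodgeConjecture.HodgeConjecture.Cruxes.H413.K2E3CharLocIntNearSemisimpleCmPrincipalSeriesThree (charLocIntNear_cmPrincipalSeries_three)
open Summit.HodgeConjecture.HodgeConjecture.Cruxes.H413.K2E3CharLocIntNearLinearCombination (charLocIntNear_add charLocIntNear_smul charLocIntNear_congr)

namespace Summit.HodgeConjecture.HodgeConjecture.Cruxes.H413.K2E3CharLocIntNearSemisimpleResidualThreeOfCut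

set_option maxHeartbeats 1600000 in
set_option synthInstance.maxHeartbeats 400000 in
-- statement-heavy: the ∀-closed letter and the socket both carry `IrrClass.smoothTrace` ∕ `IsConstituentOf (cmPrincipalSeries L 3 v χ)` over the carrier `Gqs L v`
-- (the default budget times out at `isDefEq`, exactly as MAIN :945 and K2E3-p36 (g0)'s kernel-elaborated letter scratch)
/-- **LEAF (11-3ns-res) FROM THE LETTER (res3-CI)** — the bytes of the MAIN leaf `sig_K2E3CharLocIntNearSemisimpleResidualThree` (:945–:960), token for token, from the ONE
∀-closed antecedent `hCI₃` «for `c` a constituent of a REDUCIBLE `cmPrincipalSeries L 3 v χ` (`χ` continuous, `v` non-split) not of case (1), and every SEMISIMPLE `s`: there are an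
open `U ∋ s` and `Δ` integrable on `U` with `2·Tr c(f) − Tr i_G(χ)(f) = ∫ f·Δ dμ` for the test functions supported in `U`» (K2E3-p36 (g0)'s bytes `letter_hCI3.txt`; the merged,
classification-free form of Rogawski's character identities `Tr c − Tr c′ = ±χ^G_{ρ(θ)}` for the two-element Jordan–Hölder sets `{πⁿ, πˢ}`, `{π¹, π²}` plus the `L¹_loc` of the
transferred side).  Proof: `Tr i_G(χ)` is given near `s` by an integrable `Θ` (★ p861274 `charLocIntNear_cmPrincipalSeries_three`, letter-free van Dijk at `N = 3`), and
`Tr c = ½·(Tr i_G(χ) + (2·Tr c − Tr i_G(χ)))` on every `f` (★ (LC) `charLocIntNear_add`, `charLocIntNear_smul`, `charLocIntNear_congr`): `Θ_c = ½(Θ + Δ)` on `U_Θ ∩ U`.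
[cite: Rogawski1990, §12.2 (2)(3) pp. 173–175; Lemma 12.7.3, Cor. 12.7.4, p. 184] [cite: HarishChandra1999, Thm. 16.1 p. 77] [cite: vanDijk1972, Theorem p. 237] -/
theorem residualThree_of_cut
    (hCI₃ : ∀ (L : Type) [Field L] [NumberField L] [IsCMField L] (v : HeightOneSpectrum (𝓞 ↥(maximalRealSubfield L))),
      (∀ w : PlacesOver L v, IsCMField.complexConj L • w.1 = w.1) →
      ∀ [MeasurableSpace (Gqs L v)] [BorelSpace (Gqs L v)] (μ : Measure (Gqs L v)) [μ.IsHaarMeasure] (c : IrrClass (Gqs L v))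
        (χ : ↥(cmBorelTriple L 3 v).M →* ℂˣ), Continuous (fun t => ((χ t : ℂˣ) : ℂ)) →
        c.IsConstituentOf (cmPrincipalSeries L 3 v χ) → ¬ (cmPrincipalSeries L 3 v χ).IsIrreducible →
        (¬ ∃ ψ₀ : ↥(normOneUnits (conjLocal L (IsCMField.complexConj L) v)) →* ℂˣ, Continuous (fun x => ((ψ₀ x : ℂˣ) : ℂ)) ∧
            c.IsConstituentOf (cmPrincipalSeries L 3 v
              (cmTorusCharPair L v (halfModulusChar (LocalRing L v) * halfModulusChar (LocalRing L v))⁻¹ ψ₀))) →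
        ∀ s : Gqs L v, Module.End.IsSemisimple (Matrix.toLin' ((s.val : GL (Fin 3) (UnitaryGroup.LocalRing L v)).val : Matrix (Fin 3) (Fin 3) (UnitaryGroup.LocalRing L v))) →
          ∃ U : Set (Gqs L v), IsOpen U ∧ s ∈ U ∧
            ∃ Δ : Gqs L v → ℂ, IntegrableOn Δ U μ ∧
              ∀ f : Gqs L v → ℂ, f ∈ SchwartzBruhat (Gqs L v) → tsupport f ⊆ U →
                2 * c.smoothTrace μ f - Representation.smoothTrace (G := Gqs L v) (UnitaryGroup.cmPrincipalSeries L 3 v χ) μ f = ∫ g, f g * Δ g ∂μ) :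
  ∀ (L : Type) [Field L] [NumberField L] [IsCMField L] (v : HeightOneSpectrum (𝓞 ↥(maximalRealSubfield L))),
    (∀ w : PlacesOver L v, IsCMField.complexConj L • w.1 = w.1) →
    ∀ [MeasurableSpace (Gqs L v)] [BorelSpace (Gqs L v)] (μ : Measure (Gqs L v)) [μ.IsHaarMeasure] (c : IrrClass (Gqs L v))
      (χ : ↥(cmBorelTriple L 3 v).M →* ℂˣ), Continuous (fun t => ((χ t : ℂˣ) : ℂ)) →
      c.IsConstituentOf (cmPrincipalSeries L 3 v χ) → ¬ (cmPrincipalSeries L 3 v χ).IsIrreducible →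
      (¬ ∃ ψ₀ : ↥(normOneUnits (conjLocal L (IsCMField.complexConj L) v)) →* ℂˣ, Continuous (fun x => ((ψ₀ x : ℂˣ) : ℂ)) ∧
          c.IsConstituentOf (cmPrincipalSeries L 3 v
            (cmTorusCharPair L v (halfModulusChar (LocalRing L v) * halfModulusChar (LocalRing L v))⁻¹ ψ₀))) →
      ∀ s : Gqs L v, Module.End.IsSemisimple (Matrix.toLin' ((s.val : GL (Fin 3) (UnitaryGroup.LocalRing L v)).val : Matrix (Fin 3) (Fin 3) (UnitaryGroup.LocalRing L v))) →
        ∃ U : Set (Gqs L v), IsOpen U ∧ s ∈ U ∧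
          ∃ Θ : Gqs L v → ℂ, IntegrableOn Θ U μ ∧
            ∀ f : Gqs L v → ℂ, f ∈ SchwartzBruhat (Gqs L v) → tsupport f ⊆ U →
              c.smoothTrace μ f = ∫ g, f g * Θ g ∂μ := by
  intro L _ _ _ v hns _ _ μ _ c χ hχ hconst hred hcase s hs
  -- `Tr i_G(χ)` near `s` (van Dijk, ★) and `2·Tr c − Tr i_G(χ)` near `s` (the letter)
  have hT := charLocIntNear_cmPrincipalSeries_three L v hns μ χ hχ s
  have hD := hCI₃ L v hns μ c χ hχ hconst hred hcase s hs
  -- `Tr i_G(χ) + (2·Tr c − Tr i_G(χ))` near `s`, then `½ ·`, then the identity `Tr c = ½(Tr i_G(χ) + (2·Tr c − Tr i_G(χ)))` on every `f`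
  have hadd := charLocIntNear_add μ (Representation.smoothTrace (G := Gqs L v) (UnitaryGroup.cmPrincipalSeries L 3 v χ) μ)
    (fun f => 2 * c.smoothTrace μ f - Representation.smoothTrace (G := Gqs L v) (UnitaryGroup.cmPrincipalSeries L 3 v χ) μ f) s hT hD
  have hhalf := charLocIntNear_smul μ
    (fun f => Representation.smoothTrace (G := Gqs L v) (UnitaryGroup.cmPrincipalSeries L 3 v χ) μ f +
      (2 * c.smoothTrace μ f - Representation.smoothTrace (G := Gqs L v) (UnitaryGroup.cmPrincipalSeries L 3 v χ) μ f)) (1 / 2) s hadd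
  refine charLocIntNear_congr μ (c.smoothTrace μ)
    (fun f => 1 / 2 * (Representation.smoothTrace (G := Gqs L v) (UnitaryGroup.cmPrincipalSeries L 3 v χ) μ f +
      (2 * c.smoothTrace μ f - Representation.smoothTrace (G := Gqs L v) (UnitaryGroup.cmPrincipalSeries L 3 v χ) μ f))) s (fun f _ => ?_) hhalf
  show c.smoothTrace μ f = 1 / 2 * (Representation.smoothTrace (G := Gqs L v) (UnitaryGroup.cmPrincipalSeries L 3 v χ) μ f +
    (2 * c.smoothTrace μ f - Representation.smoothTrace (G := Gqs L v) (UnitaryGroup.cmPrincipalSeries L 3 v χ) μ f))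
  ring

end Summit.HodgeConjecture.HodgeConjecture.Cruxes.H413.K2E3CharLocIntNearSemisimpleResidualThreeOfCut

end
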